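import Mathlib.Analysis.Convex.Birkhoff
import Summits.ValiantsHypothesis.ValiantsHypothesis.Theorems.LacunarySymmetroidMatrixDescartesCensusTropicalKLawSlopes
import Summits.ValiantsHypothesis.ValiantsHypothesis.Theorems.KPlusLogSqLawTropicalBSplitDefs

/-!
# Route «KPlusLogSqLaw», crux `TropicalB` (stmt-ValiantsHypothesis-19771) — KRONECKER PRODUCTS OF DESIGNS, part 1:
# Birkhoff averaging of a regular footprint, the one-factor bound, fibres, runs and change counts

HONEST FRAMING.  Helper toward the registered stub `stub_tropThin` (⟺ `TropicalB`, OPEN) of `Cruxes/TropicalB/Lines/birth.lean`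
(crux `Summit.ValiantsHypothesis.ValiantsHypothesis.Theses.KPlusLogSqLaw.TropicalB`, item `stmt-ValiantsHypothesis-19771`, route
`KPlusLogSqLaw`; cell `pub-symmetroid`, seat val-sym-trop-p1 g13, 2026-08-27; `--supports … --as helper`).  Toolkit for part 2
(`…TropicalBKroneckerAdditive`: the unique optima of a Kronecker product of designs are the Kronecker products of the unique optima of the
factors at the same slope; products are ADDITIVE in chain length).  Structure lemmas only; nothing here bears on `TropicalB` in its window,
`WeakLifting`, DoorA26 / DoorA34, `MatrixDescartes` (stmt-ValiantsHypothesis-18050) or VP ≠ VNP.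

* `exists_perm_avg` — **BIRKHOFF AVERAGING**: a map `F : α × β → α` all of whose fibres have size `|β|`, «good» pairs `(x.1, F x)`, and
  scores `G x ≤ W x.1 (F x)` admit a permutation `σ` of `α` through good pairs with `Σ_x G x ≤ |β| · Σ_c W c (σ c)`: the footprint
  `#{b : F(c,b) = r}/|β|` is doubly stochastic, Mathlib's `exists_eq_sum_perm_of_mem_doublyStochastic` (Birkhoff–von Neumann) writes it as an
  average of permutation matrices inside its support, and some permutation of positive weight scores at least the average.
* `factor_bound` — for a design `(d₁, v₁, ε₁)`, a slope `θ` and a regular family of PRESENT incidences `(F x, x.1, μ x)`: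
  `Σ_x (θ d₁(μ x) − v₁(F x, x.1, μ x)) ≤ |β| · w_θ(q)` for some PRESENT term `q` (best present class along the averaging permutation).
* `card_filter_fst`, `card_filter_fst_comp_equiv` — fibres of the first coordinate (of a bijection) of `α × β` have size `|β|`.
* `runs_of_dominant` — along terms dominant at strictly increasing slopes a value that recurs never left (slope monotonicity);
  `card_changes_le` — hence the CHANGE STEPS of such a sequence number at most the design's unsigned row bound `DesignRowD … B`
  (injection `k ↦ p(k+1)` into the visited terms other than `p 0`; `card_image_le_succ`, cf. the tree's `card_dominant_le_succ`).
[Birkhoff–von Neumann: folklore / Mathlib; the packaging is the cell's]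
-/

set_option linter.dupNamespace false
set_option autoImplicit false

namespace Summit.ValiantsHypothesis.ValiantsHypothesis.Theorems.KPlusLogSqLaw.Kronecker

open scoped BigOperators
open Finset

/-- **BIRKHOFF AVERAGING.**  Let `F : α × β → α` hit every value exactly `|β|` times (e.g. the first coordinate of a bijection of
`α × β`), and let every pair `(x.1, F x)` be «good».  For scores `G x ≤ W x.1 (F x)` there is a permutation `σ` of `α` through good
pairs only with `Σ_x G x ≤ |β| · Σ_c W c (σ c)`: the multiset of pairs `(x.1, F x)` is `|β|` times a doubly stochastic pattern, which
Birkhoff's theorem (`exists_eq_sum_perm_of_mem_doublyStochastic`) writes as an average of permutations inside its support. [folklore] -/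
theorem exists_perm_avg {α β : Type*} [Fintype α] [DecidableEq α] [Fintype β]
    (F : α × β → α) (hfib : ∀ r : α, (univ.filter fun x : α × β => F x = r).card = Fintype.card β)
    (good : α → α → Prop) (hgood : ∀ x, good x.1 (F x))
    (G : α × β → ℤ) (W : α → α → ℤ) (hGW : ∀ x, G x ≤ W x.1 (F x)) (hβ : 0 < Fintype.card β) :
    ∃ σ : Equiv.Perm α, (∀ c, good c (σ c)) ∧ ∑ x, G x ≤ (Fintype.card β : ℤ) * ∑ c, W c (σ c) := by
  classical
  set nβ : ℕ := Fintype.card β with hnβ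
  have hnβR : (0 : ℝ) < nβ := by exact_mod_cast hβ
  -- the multiplicity pattern
  let N : α → α → ℕ := fun c r => (univ.filter fun b : β => F (c, b) = r).card
  have hNpos : ∀ c r, 0 < N c r → good c r := by
    intro c r h
    obtain ⟨b, hb⟩ := Finset.card_pos.mp h
    have hb' : F (c, b) = r := (mem_filter.mp hb).2
    have := hgood (c, b)
    rw [hb'] at this
    exact this
  have hrow : ∀ c, ∑ r, N c r = nβ := by
    intro c
    have h := (Finset.card_eq_sum_card_fiberwise (s := (univ : Finset β)) (t := (univ : Finset α))
      (f := fun b : β => F (c, b)) (fun _ _ => mem_univ _))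
    rw [card_univ] at h
    exact h.symm
  have hcol : ∀ r, ∑ c, N c r = nβ := by
    intro r
    rw [← hfib r]
    rw [card_filter, Fintype.sum_prod_type]
    refine sum_congr rfl fun c _ => ?_
    exact Finset.card_filter _ _
  -- sums of scores regrouped through the pattern
  have hregroup : ∀ (V : α → α → ℤ), ∑ x, V x.1 (F x) = ∑ c, ∑ r, (N c r : ℤ) * V c r := by
    intro V
    rw [Fintype.sum_prod_type]
    refine sum_congr rfl fun c _ => ?_
    have : ∀ b : β, V c (F (c, b)) = ∑ r, if F (c, b) = r then V c r else 0 := by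
      intro b
      rw [Finset.sum_ite_eq]
      simp
    rw [sum_congr rfl fun b _ => this b, sum_comm]
    refine sum_congr rfl fun r _ => ?_
    rw [← Finset.sum_filter, sum_const, nsmul_eq_mul]
  -- the doubly stochastic matrix
  let S : Matrix α α ℝ := fun c r => (N c r : ℝ) / nβ
  have hS : S ∈ doublyStochastic ℝ α := by
    rw [mem_doublyStochastic_iff_sum]
    refine ⟨fun c r => by positivity, fun c => ?_, fun r => ?_⟩
    · show ∑ r, (N c r : ℝ) / nβ = 1
      rw [← Finset.sum_div, div_eq_one_iff_eq hnβR.ne']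
      exact_mod_cast hrow c
    · show ∑ c, (N c r : ℝ) / nβ = 1
      rw [← Finset.sum_div, div_eq_one_iff_eq hnβR.ne']
      exact_mod_cast hcol r
  obtain ⟨w, hw0, hw1, hwS⟩ := exists_eq_sum_perm_of_mem_doublyStochastic hS
  -- entries of the decomposition
  have hentry : ∀ c r, S c r = ∑ τ, if τ c = r then w τ else 0 := by
    intro c r
    have := congrArg (fun M : Matrix α α ℝ => M c r) hwS
    simp only [Matrix.sum_apply, Matrix.smul_apply, PEquiv.toMatrix_apply, Equiv.toPEquiv_apply,
      Option.mem_def, Option.some.injEq, smul_eq_mul, mul_ite, mul_one, mul_zero] at this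
    rw [← this]
  -- support: a permutation with positive weight passes through good pairs only
  have hsupp : ∀ τ, 0 < w τ → ∀ c, good c (τ c) := by
    intro τ hτ c
    apply hNpos
    have h1 : w τ ≤ S c (τ c) := by
      rw [hentry]
      have e : w τ = (if τ c = τ c then w τ else 0) := by simp
      rw [e]
      refine Finset.single_le_sum (f := fun τ' => if τ' c = τ c then w τ' else 0) (fun τ' _ => ?_) (mem_univ τ)
      have := hw0 τ'
      split_ifs
      · exact this
      · exact le_rfl
    have h2 : (0 : ℝ) < S c (τ c) := lt_of_lt_of_le hτ h1
    have h3 : (0 : ℝ) < (N c (τ c) : ℝ) := by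
      have := mul_pos h2 hnβR
      simpa [S, div_mul_cancel₀ _ hnβR.ne'] using this
    exact_mod_cast h3
  -- the average identity: Σ_c Σ_r S c r * W c r = Σ_τ w τ * Σ_c W c (τ c)
  have havg : ∑ c, ∑ r, S c r * (W c r : ℝ) = ∑ τ, w τ * ∑ c, (W c (τ c) : ℝ) := by
    have step : ∀ c, ∑ r, S c r * (W c r : ℝ) = ∑ τ, w τ * (W c (τ c) : ℝ) := by
      intro c
      calc ∑ r, S c r * (W c r : ℝ)
          = ∑ r, ∑ τ, (if τ c = r then w τ * (W c r : ℝ) else 0) := by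
            refine sum_congr rfl fun r _ => ?_
            rw [hentry, Finset.sum_mul]
            refine sum_congr rfl fun τ _ => ?_
            split_ifs <;> simp
        _ = ∑ τ, ∑ r, (if τ c = r then w τ * (W c r : ℝ) else 0) := Finset.sum_comm
        _ = ∑ τ, w τ * (W c (τ c) : ℝ) := by
            refine sum_congr rfl fun τ _ => ?_
            rw [Finset.sum_ite_eq]
            simp
    rw [sum_congr rfl fun c _ => step c, Finset.sum_comm]
    refine sum_congr rfl fun τ _ => ?_
    rw [Finset.mul_sum]
  -- pick τ with positive weight and at least average score
  have hwpos : ∃ τ, 0 < w τ := by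
    by_contra h
    push Not at h
    have : ∑ τ, w τ = 0 := sum_eq_zero fun τ _ => le_antisymm (h τ) (hw0 τ)
    rw [hw1] at this
    exact one_ne_zero this
  set X : ℝ := ∑ c, ∑ r, S c r * (W c r : ℝ) with hX
  let P : Finset (Equiv.Perm α) := univ.filter fun τ => 0 < w τ
  have hPne : P.Nonempty := by
    obtain ⟨τ, hτ⟩ := hwpos
    exact ⟨τ, mem_filter.mpr ⟨mem_univ _, hτ⟩⟩
  have hvanish : ∀ (g : Equiv.Perm α → ℝ), ∑ τ ∈ P, w τ * g τ = ∑ τ, w τ * g τ := by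
    intro g
    rw [← Finset.sum_filter_add_sum_filter_not univ (fun τ => 0 < w τ)]
    have : ∑ τ ∈ univ.filter (fun τ => ¬ 0 < w τ), w τ * g τ = 0 :=
      sum_eq_zero fun τ hτ => by
        have h0 : w τ = 0 := le_antisymm (not_lt.mp (mem_filter.mp hτ).2) (hw0 τ)
        rw [h0, zero_mul]
    rw [this, add_zero]
  have hsumP : ∑ τ ∈ P, w τ * X ≤ ∑ τ ∈ P, w τ * ∑ c, (W c (τ c) : ℝ) := by
    rw [hvanish (fun _ => X), hvanish (fun τ => ∑ c, (W c (τ c) : ℝ)), ← Finset.sum_mul, hw1, one_mul, ← havg]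
  obtain ⟨σ, hσP, hσ⟩ := Finset.exists_le_of_sum_le hPne hsumP
  have hσpos : 0 < w σ := (mem_filter.mp hσP).2
  have hXle : X ≤ ∑ c, (W c (σ c) : ℝ) := le_of_mul_le_mul_left hσ hσpos
  refine ⟨σ, hsupp σ hσpos, ?_⟩
  -- Σ_x G x ≤ Σ_x W x.1 (F x) = nβ · X ≤ nβ · Σ_c W c (σ c)
  have h1 : ∑ x, G x ≤ ∑ x, W x.1 (F x) := sum_le_sum fun x _ => hGW x
  have h2 : ((∑ x, W x.1 (F x) : ℤ) : ℝ) = nβ * X := by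
    rw [hregroup W, hX, Finset.mul_sum]
    push_cast
    refine sum_congr rfl fun c _ => ?_
    rw [Finset.mul_sum]
    refine sum_congr rfl fun r _ => ?_
    simp only [S]
    field_simp
  have h3 : ((∑ x, G x : ℤ) : ℝ) ≤ (nβ : ℝ) * ∑ c, (W c (σ c) : ℝ) := by
    calc ((∑ x, G x : ℤ) : ℝ) ≤ ((∑ x, W x.1 (F x) : ℤ) : ℝ) := by exact_mod_cast h1
      _ = nβ * X := h2
      _ ≤ nβ * ∑ c, (W c (σ c) : ℝ) := mul_le_mul_of_nonneg_left hXle hnβR.le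
  exact_mod_cast h3

end Summit.ValiantsHypothesis.ValiantsHypothesis.Theorems.KPlusLogSqLaw.Kronecker

namespace Summit.ValiantsHypothesis.ValiantsHypothesis.Theorems.KPlusLogSqLaw.Kronecker

open Summit.ValiantsHypothesis.ValiantsHypothesis.Theorems.MatrixDescartes.Negative
open scoped BigOperators
open Finset

/-- **ONE FACTOR.**  A design `(d₁, v₁, ε₁)` of format `(m₁, K₁)`, a slope `θ`, and a family of PRESENT incidences
`(F x, x.1, μ x)` indexed by `x : Fin m₁ × β` whose row map `F` hits every row exactly `|β|` times: the total score
`Σ_x (θ·d₁(μ x) − v₁(F x, x.1, μ x))` is at most `|β|` times the tropical weight of some PRESENT term of the factor. [this cell] -/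
theorem factor_bound {m₁ K₁ : ℕ} (d₁ : Fin K₁ → ℕ) (v₁ ε₁ : Fin m₁ → Fin m₁ → Fin K₁ → ℤ) (θ : ℤ)
    {β : Type*} [Fintype β] (hβ : 0 < Fintype.card β)
    (F : Fin m₁ × β → Fin m₁) (μ : Fin m₁ × β → Fin K₁)
    (hfib : ∀ r : Fin m₁, (univ.filter fun x : Fin m₁ × β => F x = r).card = Fintype.card β)
    (hpres : ∀ x, ε₁ (F x) x.1 (μ x) ≠ 0) :
    ∃ q : Equiv.Perm (Fin m₁) × (Fin m₁ → Fin K₁), termSign ε₁ q ≠ 0 ∧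
      ∑ x, (θ * (d₁ (μ x) : ℤ) - v₁ (F x) x.1 (μ x)) ≤ (Fintype.card β : ℤ) * tropWeight d₁ v₁ θ q := by
  classical
  -- best present class at a cell (column `c`, row `r`)
  let pres : Fin m₁ → Fin m₁ → Finset (Fin K₁) := fun c r => univ.filter fun l => ε₁ r c l ≠ 0
  let val : Fin m₁ → Fin m₁ → Fin K₁ → ℤ := fun c r l => θ * (d₁ l : ℤ) - v₁ r c l
  let W : Fin m₁ → Fin m₁ → ℤ := fun c r => if h : (pres c r).Nonempty then (pres c r).sup' h (val c r) else 0
  have hgood : ∀ x, (pres x.1 (F x)).Nonempty := fun x => ⟨μ x, mem_filter.mpr ⟨mem_univ _, hpres x⟩⟩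
  have hGW : ∀ x, θ * (d₁ (μ x) : ℤ) - v₁ (F x) x.1 (μ x) ≤ W x.1 (F x) := by
    intro x
    have h := hgood x
    show val x.1 (F x) (μ x) ≤ W x.1 (F x)
    simp only [W, dif_pos h]
    exact Finset.le_sup' (val x.1 (F x)) (mem_filter.mpr ⟨mem_univ _, hpres x⟩)
  obtain ⟨σ, hσgood, hσ⟩ := exists_perm_avg F hfib (fun c r => (pres c r).Nonempty) hgood
    (fun x => θ * (d₁ (μ x) : ℤ) - v₁ (F x) x.1 (μ x)) W hGW hβ
  -- the best-class term along `σ`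
  have hbest : ∀ c, ∃ l ∈ pres c (σ c), (pres c (σ c)).sup' (hσgood c) (val c (σ c)) = val c (σ c) l :=
    fun c => Finset.exists_mem_eq_sup' (hσgood c) (val c (σ c))
  choose lam hlam_mem hlam_val using hbest
  refine ⟨(σ, lam), ?_, ?_⟩
  · unfold termSign
    refine mul_ne_zero (Units.ne_zero _) ?_
    rw [Finset.prod_ne_zero_iff]
    intro c _
    exact (mem_filter.mp (hlam_mem c)).2
  · have hW : ∀ c, W c (σ c) = val c (σ c) (lam c) := by
      intro c
      simp only [W, dif_pos (hσgood c)]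
      exact hlam_val c
    have hwt : tropWeight d₁ v₁ θ (σ, lam) = ∑ c, W c (σ c) := by
      unfold tropWeight
      rw [Finset.mul_sum, ← Finset.sum_sub_distrib]
      exact sum_congr rfl fun c _ => (hW c).symm
    rw [hwt]
    exact hσ

/-- columns with a prescribed first coordinate number `m₂`. [folklore] -/
theorem card_filter_fst {α β : Type*} [Fintype α] [Fintype β] [DecidableEq α] (r : α) :
    (univ.filter fun y : α × β => y.1 = r).card = Fintype.card β := by
  have : (univ.filter fun y : α × β => y.1 = r) = ({r} : Finset α) ×ˢ (univ : Finset β) := by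
    ext y
    simp only [mem_filter, mem_univ, true_and, mem_product, mem_singleton, and_true]
  rw [this, card_product, card_singleton, one_mul, card_univ]

/-- fibres of the first coordinate of a bijection of `α × β` have size `|β|`. [folklore] -/
theorem card_filter_fst_comp_equiv {α β : Type*} [Fintype α] [Fintype β] [DecidableEq α]
    (ρ : α × β ≃ α × β) (r : α) :
    (univ.filter fun x : α × β => (ρ x).1 = r).card = Fintype.card β := by
  classical
  rw [← card_filter_fst (β := β) r]
  have h : (univ.filter fun x : α × β => (ρ x).1 = r) =
      (univ.filter fun y : α × β => y.1 = r).map ρ.symm.toEmbedding := by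
    ext x
    simp only [mem_filter, mem_univ, true_and, mem_map_equiv, Equiv.symm_symm]
  rw [h, card_map]

end Summit.ValiantsHypothesis.ValiantsHypothesis.Theorems.KPlusLogSqLaw.Kronecker

namespace Summit.ValiantsHypothesis.ValiantsHypothesis.Theorems.KPlusLogSqLaw.Kronecker

open Summit.ValiantsHypothesis.ValiantsHypothesis.Theorems.MatrixDescartes.Negative
open Summit.ValiantsHypothesis.ValiantsHypothesis.Theorems.LacunarySymmetroidMatrixDescartes.TropicalCensus
open scoped BigOperators
open Finset

/-- runs: along terms dominant at strictly increasing slopes, a term that recurs was never left in between (slope monotonicity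
`slope_lt_of_dominant`). [folklore] -/
theorem runs_of_dominant {m₀ K₀ : ℕ} (d₀ : Fin K₀ → ℕ) (v₀ ε₀ : Fin m₀ → Fin m₀ → Fin K₀ → ℤ) {n : ℕ}
    (θ : Fin (n + 1) → ℤ) (hθ : StrictMono θ) (p : Fin (n + 1) → Equiv.Perm (Fin m₀) × (Fin m₀ → Fin K₀))
    (hp : ∀ k, IsDominant d₀ v₀ ε₀ (θ k) (p k)) {i j l : Fin (n + 1)} (hij : i ≤ j) (hjl : j ≤ l) (hil : p i = p l) :
    p j = p i := by
  by_contra hne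
  rcases hij.lt_or_eq with hij' | rfl
  · rcases hjl.lt_or_eq with hjl' | rfl
    · have a := slope_lt_of_dominant d₀ v₀ ε₀ (hθ hij') (Ne.symm hne) (hp i) (hp j)
      have b := slope_lt_of_dominant d₀ v₀ ε₀ (hθ hjl') (fun h => hne (h.trans hil.symm)) (hp j) (hp l)
      rw [hil] at a
      exact absurd (a.trans b) (lt_irrefl _)
    · exact hne hil.symm
  · exact hne rfl

/-- the terms visited by a sequence of terms dominant at strictly increasing slopes number at most `B₀ + 1`, `B₀` the design's
unsigned row bound: list the distinct visited terms by the slope of one visit — a dominant chain. [folklore; cf. the tree's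
`card_dominant_le_succ`] -/
theorem card_image_le_succ {m₀ K₀ : ℕ} (d₀ : Fin K₀ → ℕ) (v₀ ε₀ : Fin m₀ → Fin m₀ → Fin K₀ → ℤ) {B₀ : ℕ}
    (h₀ : DesignRowD d₀ v₀ ε₀ B₀) {n : ℕ}
    (θ : Fin (n + 1) → ℤ) (hθ : StrictMono θ) (p : Fin (n + 1) → Equiv.Perm (Fin m₀) × (Fin m₀ → Fin K₀))
    (hp : ∀ k, IsDominant d₀ v₀ ε₀ (θ k) (p k)) :
    (univ.image p).card ≤ B₀ + 1 := by
  classical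
  set V := univ.image p with hV
  obtain ⟨N, hN⟩ : ∃ N, V.card = N + 1 :=
    ⟨V.card - 1, by
      have : 0 < V.card := Finset.card_pos.mpr ⟨p 0, mem_image_of_mem p (mem_univ _)⟩
      omega⟩
  -- one visiting index per visited term
  have hidx : ∀ q ∈ V, ∃ k, p k = q := fun q hq => by
    obtain ⟨k, -, hk⟩ := mem_image.mp hq
    exact ⟨k, hk⟩
  choose! idx hidx' using hidx
  have hinj : Set.InjOn (fun q => θ (idx q)) V := by
    intro q hq q' hq' hqq'
    have := hθ.injective hqq'
    rw [← hidx' q hq, ← hidx' q' hq', this]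
  set Θ := V.image (fun q => θ (idx q)) with hΘ
  have hΘcard : Θ.card = N + 1 := by rw [hΘ, card_image_of_injOn hinj, hN]
  set g := Θ.orderEmbOfFin hΘcard with hg
  have hterm : ∀ i : Fin (N + 1), ∃ q ∈ V, θ (idx q) = g i := by
    intro i
    have hi : g i ∈ Θ := Θ.orderEmbOfFin_mem hΘcard i
    obtain ⟨q, hq, hqi⟩ := mem_image.mp hi
    exact ⟨q, hq, hqi⟩
  choose term hterm_mem hterm_slope using hterm
  have hdom : ∀ i, IsDominant d₀ v₀ ε₀ (g i) (term i) := by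
    intro i
    have e1 : p (idx (term i)) = term i := hidx' _ (hterm_mem i)
    have h2 := hp (idx (term i))
    rw [e1] at h2
    rw [← hterm_slope i]
    exact h2
  have hne : ∀ k : Fin N, term k.castSucc ≠ term k.succ := by
    intro k heq
    have h1 : g k.castSucc = g k.succ := by rw [← hterm_slope, ← hterm_slope, heq]
    exact absurd h1 (ne_of_lt (g.strictMono Fin.castSucc_lt_succ))
  have hle : N ≤ B₀ := h₀ N (fun i => g i) term g.strictMono hdom hne
  omega

/-- the change steps of a factor along a chain are at most its unsigned row bound. [this cell] -/
theorem card_changes_le {m₀ K₀ : ℕ} (d₀ : Fin K₀ → ℕ) (v₀ ε₀ : Fin m₀ → Fin m₀ → Fin K₀ → ℤ) {B₀ : ℕ}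
    (h₀ : DesignRowD d₀ v₀ ε₀ B₀) {n : ℕ}
    (θ : Fin (n + 1) → ℤ) (hθ : StrictMono θ) (p : Fin (n + 1) → Equiv.Perm (Fin m₀) × (Fin m₀ → Fin K₀))
    (hp : ∀ k, IsDominant d₀ v₀ ε₀ (θ k) (p k)) :
    (univ.filter fun k : Fin n => p k.castSucc ≠ p k.succ).card ≤ B₀ := by
  classical
  set D := univ.image p with hD
  have hDcard : D.card ≤ B₀ + 1 := card_image_le_succ d₀ v₀ ε₀ h₀ θ hθ p hp
  have hmemD : ∀ k, p k ∈ D := fun k => mem_image_of_mem p (mem_univ _)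
  have h0 : p 0 ∈ D := hmemD 0
  have hmaps : ∀ k ∈ (univ.filter fun k : Fin n => p k.castSucc ≠ p k.succ), p k.succ ∈ D.erase (p 0) := by
    intro k hk
    have hk' := (mem_filter.mp hk).2
    refine mem_erase.mpr ⟨fun heq => hk' ?_, hmemD _⟩
    have := runs_of_dominant d₀ v₀ ε₀ θ hθ p hp (i := 0) (j := k.castSucc) (l := k.succ) (Fin.zero_le _)
      (Fin.castSucc_lt_succ).le heq.symm
    rw [this, heq]
  have hinj : Set.InjOn (fun k : Fin n => p k.succ) ↑(univ.filter fun k : Fin n => p k.castSucc ≠ p k.succ) := by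
    intro k hk k' hk' hkk'
    have hk₁ := (mem_filter.mp (Finset.mem_coe.mp hk)).2
    have hk'₁ := (mem_filter.mp (Finset.mem_coe.mp hk')).2
    simp only at hkk'
    by_contra hne
    rcases lt_or_gt_of_ne hne with hlt | hlt
    · apply hk'₁
      have hle : k.succ ≤ k'.castSucc := Fin.le_iff_val_le_val.2 (by rw [Fin.val_succ, Fin.val_castSucc]; exact hlt)
      have := runs_of_dominant d₀ v₀ ε₀ θ hθ p hp hle (Fin.castSucc_lt_succ).le hkk'
      rw [this, hkk']
    · apply hk₁
      have hle : k'.succ ≤ k.castSucc := Fin.le_iff_val_le_val.2 (by rw [Fin.val_succ, Fin.val_castSucc]; exact hlt)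
      have := runs_of_dominant d₀ v₀ ε₀ θ hθ p hp hle (Fin.castSucc_lt_succ).le hkk'.symm
      rw [this, hkk']
  have h1 := Finset.card_le_card_of_injOn (fun k : Fin n => p k.succ) hmaps hinj
  rw [Finset.card_erase_of_mem h0] at h1
  omega

end Summit.ValiantsHypothesis.ValiantsHypothesis.Theorems.KPlusLogSqLaw.Kronecker
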